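import Mathlib.NumberTheory.Padics.RingHoms
import Mathlib.GroupTheory.Index
import Mathlib.LinearAlgebra.Span.Basic
import Mathlib.SetTheory.Cardinal.Finite
import HarnessLib

/-!
# The zeta-line saturation of crux M's A-side junction from its COUNTING form: for `Y = ℤ_p y₀` and a subgroup `L` with `p^r Y ≤ L`,
# `{c : c•y₀ ∈ L} = p^j ℤ_p` for some `j ≤ r`, `[Y : Y ⊓ L] = p^j`, hence `p^N ∣ [Y : Y ⊓ L] ⟹ Y ⊓ L ≤ p^N Y`
# (route `KatoDescentPotSupersingular` / `…Tame…`, crux M = stmt-BirchSwinnertonDyer-19196; route-free helper)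

Seat `bsd-potss-rkm` g20 (prover; cell `bsd-potss`), item stmt-BirchSwinnertonDyer-19196 (`--supports … --as helper`; closes nothing).
HONEST FRAMING: BSD is not proved by any of this; nothing is booked; theorems only (no definition, no named fact).  Pure `ℤ_p`-algebra.

## Why

Part 49 (`KatoFiniteLevelCount.exists_forall_aSide_le`) consumes brick (b) of crux M's level-0 ledger (Kato Lemma 14.18 + the value of the dual
exponential) in SUBGROUP form: `hY : ℤ_p y₀ ∩ f_k⁻¹(𝓚_k^⊥) ⊆ p^N ℤ_p y₀`.  The natural output of an explicit-reciprocity computation is a COUNT: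
the order `p^{k−e}` of the image of the zeta line `ℤ_p y₀` in `H¹(ℚ_p, E[p^k]^D)/𝓚_k^⊥` (equivalently, by the perfect-pairing count of part 32,
`#𝓚_k/#(𝓚_k ∩ (loc_p red_k y₀)^⊥)` — the local Tate pairing of `red_k y₀` against the Kummer classes).  This file turns the count into the subgroup
form, using only that the target of `f_k` is killed by a power of `p`:

* `exists_forall_smul_mem_iff_pow_dvd` — `M` a `ℤ_p`-module, `y₀ ∈ M`, `L ≤ M` a subgroup with `(p^r c) • y₀ ∈ L` for all `c`: there is `j ≤ r`
  with `c • y₀ ∈ L ↔ p^j ∣ c` (the set `{c : c•y₀ ∈ L}` is an ideal — closed under `ℤ_p` because `ℤ` is dense modulo `p^r` (`PadicInt.appr`) —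
  hence `= (p^j)`, `ℤ_p` being a DVR);
* `relIndex_span_singleton_eq_pow` — then `[Y : Y ⊓ L] = p^j` (`Y = ℤ_p ∙ y₀`; `Y/(Y ⊓ L) ≅ ℤ_p/(p^j) ≅ ℤ/p^j`, `PadicInt.toZModPow`);
* **`exists_mem_smul_eq_of_pow_dvd_relIndex`** — so `p^N ∣ [Y : Y ⊓ L]` gives `∀ y ∈ Y ⊓ L, ∃ y' ∈ Y, p^N • y' = y` (the hypothesis `hY` of part 49
  with `L = f_k⁻¹(𝓚_k^⊥)`), and `forall_smul_mem_iff_of_relIndex_eq` — `[Y : Y ⊓ L] = p^j ⟹ (c•y₀ ∈ L ↔ p^j ∣ c)`.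

References: K. Kato, Astérisque 295 (2004), Lemma 14.18 and proof of Prop. 14.16 (2) (pp. 244–248) [Kato2004Asterisque]; J.-P. Serre, *Local Fields*,
Ch. I §3 (ideals of a DVR) [SerreLocalFields1979].
-/

-- the summit and its single problem are both named `BirchSwinnertonDyer` (registry layout D-0017)
set_option linter.dupNamespace false
set_option autoImplicit false

namespace Summit.BirchSwinnertonDyer.BirchSwinnertonDyer.Theorems.ASideJunction

section PadicLine

variable {p : ℕ} [hp : Fact p.Prime] {M : Type*} [AddCommGroup M] [Module ℤ_[p] M]

/-- **`{c ∈ ℤ_p : c • y₀ ∈ L} = (p^j)` for some `j ≤ r`** whenever the subgroup `L` contains `p^r ℤ_p y₀`: the set is an additive subgroup closed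
under multiplication by `ℤ_p` (write `t = m + p^r w` with `m ∈ ℕ`, `PadicInt.appr`), i.e. an ideal of the discrete valuation ring `ℤ_p`, non-zero
since it contains `p^r`. [cite: SerreLocalFields1979, Ch. I §3 (ideals of a DVR)] [cite: Kato2004Asterisque, proof of Lemma 14.18 (pp. 247–248)] -/
theorem exists_forall_smul_mem_iff_pow_dvd (y₀ : M) (L : AddSubgroup M) (r : ℕ)
    (hr : ∀ c : ℤ_[p], ((p : ℤ_[p]) ^ r * c) • y₀ ∈ L) :
    ∃ j : ℕ, j ≤ r ∧ ∀ c : ℤ_[p], c • y₀ ∈ L ↔ (p : ℤ_[p]) ^ j ∣ c := by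
  -- the ideal `I = {c : c • y₀ ∈ L}`
  let I : Ideal ℤ_[p] :=
    { carrier := {c | c • y₀ ∈ L}
      zero_mem' := by simp only [Set.mem_setOf_eq, zero_smul]; exact L.zero_mem
      add_mem' := fun {a b} ha hb => by
        simp only [Set.mem_setOf_eq] at ha hb ⊢
        rw [add_smul]; exact L.add_mem ha hb
      smul_mem' := fun t c hc => by
        simp only [Set.mem_setOf_eq, smul_eq_mul] at hc ⊢
        obtain ⟨w, hw⟩ := Ideal.mem_span_singleton.mp (PadicInt.appr_spec r t)
        have ht : t = (PadicInt.appr t r : ℤ_[p]) + (p : ℤ_[p]) ^ r * w := by rw [← hw]; ring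
        have h1 : ((PadicInt.appr t r : ℤ_[p]) * c) • y₀ ∈ L := by
          rw [mul_smul, Nat.cast_smul_eq_nsmul]; exact L.nsmul_mem hc _
        rw [ht, add_mul, mul_assoc, add_smul]
        exact L.add_mem h1 (hr (w * c)) }
  have hI : ∀ c : ℤ_[p], c ∈ I ↔ c • y₀ ∈ L := fun c => Iff.rfl
  have hpr : (p : ℤ_[p]) ^ r ∈ I := by rw [hI]; simpa using hr 1
  have hp0 : (p : ℤ_[p]) ≠ 0 := by exact_mod_cast hp.out.ne_zero
  have hI0 : I ≠ ⊥ := fun h => pow_ne_zero r hp0 (by rw [h, Ideal.mem_bot] at hpr; exact hpr)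
  obtain ⟨j, hj⟩ := PadicInt.ideal_eq_span_pow_p hI0
  refine ⟨j, ?_, fun c => ?_⟩
  · have h : (p : ℤ_[p]) ^ j ∣ (p : ℤ_[p]) ^ r := by
      rw [← Ideal.mem_span_singleton, ← hj]; exact hpr
    exact (pow_dvd_pow_iff hp0 PadicInt.irreducible_p.not_isUnit).mp h
  · rw [← hI, hj, Ideal.mem_span_singleton]

/-- **`[ℤ_p y₀ : ℤ_p y₀ ⊓ L] = p^j`** when `c • y₀ ∈ L ↔ p^j ∣ c`: `c ↦ c • y₀` induces `ℤ_p/(p^j) ≅ Y/(Y ⊓ L)` and `ℤ_p/(p^j) ≅ ℤ/p^j`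
(`PadicInt.toZModPow`). [cite: SerreLocalFields1979, Ch. I §3] [cite: Kato2004Asterisque, proof of Prop. 14.16 (2) (pp. 244–245)] -/
theorem relIndex_span_singleton_eq_pow (y₀ : M) (L : AddSubgroup M) (j : ℕ)
    (hj : ∀ c : ℤ_[p], c • y₀ ∈ L ↔ (p : ℤ_[p]) ^ j ∣ c) :
    L.relIndex (ℤ_[p] ∙ y₀).toAddSubgroup = p ^ j := by
  set φ : ℤ_[p] →+ M := (LinearMap.toSpanSingleton ℤ_[p] M y₀).toAddMonoidHom with hφ
  have hY : (ℤ_[p] ∙ y₀).toAddSubgroup = (⊤ : AddSubgroup ℤ_[p]).map φ := by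
    rw [LinearMap.span_singleton_eq_range ℤ_[p] M y₀, LinearMap.range_toAddSubgroup, AddMonoidHom.range_eq_map]
  have hcomap : L.comap φ = (Ideal.span {(p : ℤ_[p]) ^ j}).toAddSubgroup := by
    ext c
    rw [AddSubgroup.mem_comap, Submodule.mem_toAddSubgroup, Ideal.mem_span_singleton, ← hj]
    rfl
  rw [hY, ← AddSubgroup.relIndex_comap, AddSubgroup.relIndex_top_right, hcomap]
  -- `[ℤ_p : (p^j)] = #(ℤ_p ⧸ (p^j)) = #ℤ/p^j = p^j`
  have e : ℤ_[p] ⧸ Ideal.span {(p : ℤ_[p]) ^ j} ≃+* ZMod (p ^ j) :=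
    (Ideal.quotEquivOfEq (PadicInt.ker_toZModPow j).symm).trans
      (RingHom.quotientKerEquivOfSurjective (ZMod.ringHom_surjective (PadicInt.toZModPow j)))
  change Nat.card (ℤ_[p] ⧸ Ideal.span {(p : ℤ_[p]) ^ j}) = p ^ j
  rw [Nat.card_congr e.toEquiv, Nat.card_zmod]

/-- **`[Y : Y ⊓ L] = p^j ⟹ (c • y₀ ∈ L ↔ p^j ∣ c)`** (`Y = ℤ_p y₀`, `p^r Y ≤ L`): the exponent of `exists_forall_smul_mem_iff_pow_dvd` is read
off the index. [cite: Kato2004Asterisque, proof of Prop. 14.16 (2) and Lemma 14.18 (pp. 244–248)] -/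
theorem forall_smul_mem_iff_of_relIndex_eq (y₀ : M) (L : AddSubgroup M) (r : ℕ)
    (hr : ∀ c : ℤ_[p], ((p : ℤ_[p]) ^ r * c) • y₀ ∈ L) (j : ℕ) (hj : L.relIndex (ℤ_[p] ∙ y₀).toAddSubgroup = p ^ j) :
    ∀ c : ℤ_[p], c • y₀ ∈ L ↔ (p : ℤ_[p]) ^ j ∣ c := by
  obtain ⟨j', -, hj'⟩ := exists_forall_smul_mem_iff_pow_dvd y₀ L r hr
  have h := relIndex_span_singleton_eq_pow y₀ L j' hj'
  rw [hj] at h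
  rw [Nat.pow_right_injective hp.out.two_le h]
  exact hj'

/-- **The zeta-line saturation from the count: `p^N ∣ [Y : Y ⊓ L] ⟹ ∀ y ∈ Y ⊓ L, ∃ y' ∈ Y, p^N • y' = y`** (`Y = ℤ_p y₀`, `p^r Y ≤ L`) —
the hypothesis `hY` of `KatoFiniteLevelCount.exists_forall_aSide_le` (part 49) with `L = f_k⁻¹(𝓚_k^⊥)`, from brick (b) in counting form
(`[B_k(ℤ_p y₀) : B_k(ℤ_p y₀) ⊓ 𝓚_k^⊥] = p^{k−e}`, any `k ≥ N + e`). [cite: Kato2004Asterisque, Lemma 14.18 and proof of Prop. 14.16 (2) (pp. 244–248)] -/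
theorem exists_mem_smul_eq_of_pow_dvd_relIndex (y₀ : M) (L : AddSubgroup M) (r : ℕ)
    (hr : ∀ c : ℤ_[p], ((p : ℤ_[p]) ^ r * c) • y₀ ∈ L) (N : ℕ) (hN : p ^ N ∣ L.relIndex (ℤ_[p] ∙ y₀).toAddSubgroup) :
    ∀ y ∈ (ℤ_[p] ∙ y₀).toAddSubgroup, y ∈ L → ∃ y' ∈ (ℤ_[p] ∙ y₀).toAddSubgroup, ((p ^ N : ℕ) : ℤ) • y' = y := by
  obtain ⟨j, -, hj⟩ := exists_forall_smul_mem_iff_pow_dvd y₀ L r hr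
  have hidx := relIndex_span_singleton_eq_pow y₀ L j hj
  rw [hidx] at hN
  have hNj : N ≤ j := (Nat.pow_dvd_pow_iff_le_right hp.out.one_lt).mp hN
  intro y hy hyL
  rw [Submodule.mem_toAddSubgroup, Submodule.mem_span_singleton] at hy
  obtain ⟨c, rfl⟩ := hy
  obtain ⟨c', rfl⟩ := (pow_dvd_pow (p : ℤ_[p]) hNj).trans ((hj c).mp hyL)
  refine ⟨c' • y₀, ?_, ?_⟩
  · rw [Submodule.mem_toAddSubgroup]
    exact Submodule.smul_mem _ c' (Submodule.mem_span_singleton_self y₀)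
  · rw [mul_smul, ← Nat.cast_pow, Nat.cast_smul_eq_nsmul ℤ_[p], Nat.cast_smul_eq_nsmul ℤ]

end PadicLine

end Summit.BirchSwinnertonDyer.BirchSwinnertonDyer.Theorems.ASideJunction
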